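import Summits.CriticalPhenomena.Ising3DConformalLimit.Theorems.FKParityRobustnessStrandShadowOddCutDefs
import Summits.CriticalPhenomena.Ising3DConformalLimit.Theorems.StrandShadow.Negative.PairSplitDeletion
import Summits.CriticalPhenomena.Ising3DConformalLimit.Theorems.FKParityRobustnessStrandShadowComposition
import Literature.Probability.LatticeModels.GKSInequalities
import Literature.Probability.LatticeModels.LoopO1
import HarnessLib

/-!
# Contact joins: `AJ·Z∅ + t²·(contact pairing mass)·Z∅ ≤ JJ`
# (support lemma for the crux `StrandShadow`, stmt-CriticalPhenomena-14626, line `odd-cluster-cut-exact-helper`)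

In the vocabulary of `Theorems/FKParityRobustnessStrandShadowOddCutDefs.lean` (loop-O(1) dress of
Aizenman's double current `n^A + n^∅`: `F ∈ 𝒯_A`, `F′ ∈ 𝒯_∅`, sprinkle `η ~ Bernoulli(t²)^{⊗E}`,
joined mass `JJ = jointJoinMass`, all-joined mass `AJ = allJoinedMass`, pairing set `pairingSet`),
the simplest lower bound on the joined mass: a pairing configuration `F` (pairing `01|23`) whose two
odd clusters `K_{a₀}(F) ∋ a₀,a₁` and `K_{a₂}(F) ∋ a₂,a₃` are ADJACENT in `G` — some edge `e = {x,y}`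
of `G` has `a₀ ↝_F x` and `a₂ ↝_F y` — is joined by every sprinkle containing `e`, an event of
`η`-probability exactly `t²`; the all-joined configurations are joined by every `(F′, η)`.  Hence

`allJoinedMass·Z∅ + t²·(Σ_{F ∈ pairingSet, contact} t^{|F|})·Z∅ ≤ jointJoinMass`

(`jointJoinMass_ge_allJoined_add_contact`).  With Aizenman's dictionary
`(ΣGG − ⟨σ_A⟩)·Z∅² = 2·JJ` this turns a CONTACT FLOOR "the two odd clusters of a critical pairing
configuration touch with probability `≥ p`" into the lattice clause (iii) `INT` with
`κ = min(1, t²p/3)` (`int_of_contactFloor_arith`, pure arithmetic) — the contact mechanism that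
the line's bridge count `bridges` deliberately excludes (its attaching pairs have distinct feet
`u ≠ v` in the holed volume), recorded here because in the very subcritical medium
(`t_c² ≈ 0.048 ≪ p_c`) contacts and short bridges are the dominant joining mechanism.
-/

noncomputable section

open Finset SimpleGraph
open Literature.Probability.LatticeModels
open Summit.CriticalPhenomena.Ising3DConformalLimit.StrandShadowNegative

namespace Summit.CriticalPhenomena.Ising3DConformalLimit.Theorems.StrandShadowOddCut

open scoped Classical

section Contact

variable {V : Type*} [Fintype V] [DecidableEq V] (G : SimpleGraph V) [DecidableRel G.Adj]

omit [DecidableEq V] in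
/-- The sprinkle weights form a probability: `Σ_{η ⊆ E} (t²)^{|η|}(1−t²)^{|E|−|η|} = 1`. -/
theorem sum_etaWeight_eq_one (t : ℝ) :
    ∑ η ∈ G.edgeFinset.powerset, etaWeight G t η = 1 := by
  unfold etaWeight
  rw [Finset.sum_pow_mul_eq_add_pow]
  simp

/-- The sprinkle contains a given edge `e ∈ E` with probability `t²`:
`Σ_{η ∋ e} (t²)^{|η|}(1−t²)^{|E|−|η|} = t²`. -/
theorem sum_etaWeight_filter_mem (t : ℝ) {e : Sym2 V} (he : e ∈ G.edgeFinset) :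
    ∑ η ∈ G.edgeFinset.powerset.filter (fun η => e ∈ η), etaWeight G t η = t ^ 2 := by
  -- `η ↦ η.erase e` is a bijection from `{η ∋ e}` onto the subsets of `E.erase e`, and
  -- `w(η) = t² · w'(η.erase e)` with `w'` the sprinkle weight on `E.erase e`.
  have hcard : #G.edgeFinset = #(G.edgeFinset.erase e) + 1 := by
    rw [Finset.card_erase_of_mem he, Nat.sub_add_cancel (Finset.card_pos.2 ⟨e, he⟩)]
  have hsub : ∀ η ∈ G.edgeFinset.powerset.filter (fun η => e ∈ η),
      etaWeight G t η = t ^ 2 * ((t ^ 2) ^ #(η.erase e) * (1 - t ^ 2) ^ (#(G.edgeFinset.erase e) - #(η.erase e))) := by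
    intro η hη
    rw [Finset.mem_filter, Finset.mem_powerset] at hη
    unfold etaWeight
    have h1 : #η = #(η.erase e) + 1 := by
      rw [Finset.card_erase_of_mem hη.2, Nat.sub_add_cancel (Finset.card_pos.2 ⟨e, hη.2⟩)]
    rw [h1, hcard, Nat.add_sub_add_right, pow_succ]
    ring
  rw [Finset.sum_congr rfl hsub, ← Finset.mul_sum]
  have hbij : ∑ η ∈ G.edgeFinset.powerset.filter (fun η => e ∈ η),
      (t ^ 2) ^ #(η.erase e) * (1 - t ^ 2) ^ (#(G.edgeFinset.erase e) - #(η.erase e)) =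
      ∑ η' ∈ (G.edgeFinset.erase e).powerset,
        (t ^ 2) ^ #η' * (1 - t ^ 2) ^ (#(G.edgeFinset.erase e) - #η') := by
    refine Finset.sum_nbij' (fun η => η.erase e) (fun η' => insert e η') ?_ ?_ ?_ ?_ ?_
    · intro η hη
      rw [Finset.mem_filter, Finset.mem_powerset] at hη
      rw [Finset.mem_powerset]
      exact Finset.erase_subset_erase e hη.1
    · intro η' hη'
      rw [Finset.mem_powerset, Finset.subset_erase] at hη'
      rw [Finset.mem_filter, Finset.mem_powerset]
      exact ⟨Finset.insert_subset he hη'.1, Finset.mem_insert_self e η'⟩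
    · intro η hη
      rw [Finset.mem_filter] at hη
      exact Finset.insert_erase hη.2
    · intro η' hη'
      rw [Finset.mem_powerset, Finset.subset_erase] at hη'
      exact Finset.erase_insert hη'.2
    · intro η _; rfl
  rw [hbij, Finset.sum_pow_mul_eq_add_pow]
  simp

omit [Fintype V] in
/-- Reachability inside `F` passes to `F ∪ F′ ∪ η`. -/
theorem rch_union_union {F F' η : Finset (Sym2 V)} {x v : V} (h : Rch F x v) :
    Rch (F ∪ F' ∪ η) x v :=
  rch_mono (Finset.subset_union_left.trans Finset.subset_union_left) h

omit [Fintype V] in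
/-- An edge of `η` joins its endpoints inside `F ∪ F′ ∪ η`. -/
theorem rch_of_adj_mem {F F' η : Finset (Sym2 V)} {x y : V} (hxy : x ≠ y) (he : s(x, y) ∈ η) :
    Rch (F ∪ F' ∪ η) x y := by
  have hadj : (SimpleGraph.fromEdgeSet (↑(F ∪ F' ∪ η) : Set (Sym2 V))).Adj x y := by
    rw [SimpleGraph.fromEdgeSet_adj]
    exact ⟨Finset.mem_coe.2 (Finset.mem_union_right _ he), hxy⟩
  exact hadj.reachable

/-- In a pairing configuration (`¬ a₀ ↝ a₂`, `¬ a₀ ↝ a₃`), `a₁` lies in the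
`a₀`-cluster and `a₃` in the `a₂`-cluster (handshake, `rch_a1` twice). -/
theorem rch_pairing_partners {a : Fin 4 → V} {F : Finset (Sym2 V)}
    (hF : F ∈ tJoins G Set.univ (Finset.univ.image a)) (h2 : ¬ Rch F (a 0) (a 2))
    (h3 : ¬ Rch F (a 0) (a 3)) : Rch F (a 0) (a 1) ∧ Rch F (a 2) (a 3) := by
  have hmem : ∀ i, a i ∈ Finset.univ.image a := fun i => Finset.mem_image_of_mem a (Finset.mem_univ i)
  have hcases : ∀ v ∈ Finset.univ.image a, v = a 0 ∨ v = a 1 ∨ v = a 2 ∨ v = a 3 := by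
    intro v hv
    obtain ⟨i, -, rfl⟩ := Finset.mem_image.1 hv
    fin_cases i <;> simp
  have h01 : Rch F (a 0) (a 1) := by
    refine rch_a1 G (hmem 0) (fun v hv hr => ?_) hF
    rcases hcases v hv with rfl | rfl | rfl | rfl
    · exact Or.inl rfl
    · exact Or.inr rfl
    · exact absurd hr h2
    · exact absurd hr h3
  refine ⟨h01, rch_a1 G (hmem 2) (fun v hv hr => ?_) hF⟩
  rcases hcases v hv with rfl | rfl | rfl | rfl
  · exact absurd hr.symm h2
  · exact absurd (h01.trans hr.symm) h2
  · exact Or.inl rfl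
  · exact Or.inr rfl

/-- **Contact joins**: the all-joined `A`-joins and the pairing `A`-joins whose two odd clusters are
adjacent in `G` give `AJ·Z∅ + t²·(contact pairing mass)·Z∅ ≤ JJ`. -/
theorem jointJoinMass_ge_allJoined_add_contact :
    ∀ (V : Type) [Fintype V] [DecidableEq V] (G : SimpleGraph V) [DecidableRel G.Adj] (β : ℝ),
      0 ≤ β → ∀ a : Fin 4 → V,
      allJoinedMass G β a * loopO1PartitionFunction G (Real.tanh β) ∅ +
        Real.tanh β ^ 2 *
          (∑ F ∈ (pairingSet G a).filter (fun F : Finset (Sym2 V) =>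
              ∃ x y : V, G.Adj x y ∧ Rch F (a 0) x ∧ Rch F (a 2) y), Real.tanh β ^ F.card) *
          loopO1PartitionFunction G (Real.tanh β) ∅
        ≤ jointJoinMass G β a := by
  intro V _ _ G _ β hβ a
  set t := Real.tanh β with ht
  have ht0 : 0 ≤ t := by
    rw [ht, Real.tanh_eq_sinh_div_cosh]
    exact div_nonneg (Real.sinh_nonneg_iff.2 hβ) (Real.cosh_pos _).le
  have hw0 : ∀ η, 0 ≤ etaWeight G t η := fun η => by rw [ht]; exact etaWeight_nonneg G β η
  -- the summand of `JJ`
  set g : Finset (Sym2 V) → Finset (Sym2 V) → Finset (Sym2 V) → ℝ := fun F F' η =>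
    if (∀ i j : Fin 4, Rch (F ∪ F' ∪ η) (a i) (a j)) then t ^ F.card * t ^ F'.card * etaWeight G t η
    else 0 with hg
  have hg0 : ∀ F F' η, 0 ≤ g F F' η := fun F F' η => by
    simp only [hg]; split_ifs
    · exact mul_nonneg (mul_nonneg (pow_nonneg ht0 _) (pow_nonneg ht0 _)) (hw0 η)
    · exact le_rfl
  have hJJ : jointJoinMass G β a = ∑ F ∈ tJoins G Set.univ (Finset.univ.image a),
      ∑ F' ∈ tJoins G Set.univ (∅ : Finset V), ∑ η ∈ G.edgeFinset.powerset, g F F' η := by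
    rfl
  have hZ0 : loopO1PartitionFunction G t ∅ = ∑ F' ∈ tJoins G Set.univ (∅ : Finset V), t ^ F'.card :=
    loopO1PartitionFunction_eq_sum_tJoins G t ∅
  -- the two disjoint `F`-sets
  set SA := (tJoins G Set.univ (Finset.univ.image a)).filter (fun F : Finset (Sym2 V) =>
      Rch F (a 0) (a 1) ∧ Rch F (a 0) (a 2) ∧ Rch F (a 0) (a 3)) with hSA
  set SC := (pairingSet G a).filter (fun F : Finset (Sym2 V) =>
      ∃ x y : V, G.Adj x y ∧ Rch F (a 0) x ∧ Rch F (a 2) y) with hSC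
  have hSAsub : SA ⊆ tJoins G Set.univ (Finset.univ.image a) := Finset.filter_subset _ _
  have hSCsub : SC ⊆ tJoins G Set.univ (Finset.univ.image a) :=
    (Finset.filter_subset _ _).trans (Finset.filter_subset _ _)
  have hdisj : Disjoint SA SC := by
    rw [Finset.disjoint_left]
    intro F hFA hFC
    rw [hSA, Finset.mem_filter] at hFA
    rw [hSC, Finset.mem_filter, pairingSet, Finset.mem_filter] at hFC
    exact hFC.1.2.1 hFA.2.2.1
  -- (1) all-joined configurations: the summand is the full weight
  have hA : ∀ F ∈ SA, ∑ F' ∈ tJoins G Set.univ (∅ : Finset V), ∑ η ∈ G.edgeFinset.powerset, g F F' η =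
      t ^ F.card * loopO1PartitionFunction G t ∅ := by
    intro F hF
    rw [hSA, Finset.mem_filter] at hF
    obtain ⟨-, h1, h2, h3⟩ := hF
    have hall : ∀ F' η : Finset (Sym2 V), ∀ i j : Fin 4, Rch (F ∪ F' ∪ η) (a i) (a j) := by
      intro F' η
      have h0 : ∀ i : Fin 4, Rch (F ∪ F' ∪ η) (a 0) (a i) := by
        intro i; fin_cases i
        · exact rch_refl _ _
        · exact rch_union_union h1
        · exact rch_union_union h2
        · exact rch_union_union h3
      intro i j
      exact (h0 i).symm.trans (h0 j)
    have : ∀ F' ∈ tJoins G Set.univ (∅ : Finset V), ∑ η ∈ G.edgeFinset.powerset, g F F' η =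
        t ^ F.card * t ^ F'.card := by
      intro F' _
      simp only [hg, if_pos (hall F' _)]
      rw [← Finset.mul_sum, sum_etaWeight_eq_one, mul_one]
    rw [Finset.sum_congr rfl this, ← Finset.mul_sum, hZ0]
  -- (2) contact pairing configurations: restricting `η` to the sprinkles containing the contact edge
  have hC : ∀ F ∈ SC, t ^ 2 * t ^ F.card * loopO1PartitionFunction G t ∅ ≤
      ∑ F' ∈ tJoins G Set.univ (∅ : Finset V), ∑ η ∈ G.edgeFinset.powerset, g F F' η := by
    intro F hF
    rw [hSC, Finset.mem_filter, pairingSet, Finset.mem_filter] at hF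
    obtain ⟨⟨hFT, h2, h3⟩, x, y, hxy, hx, hy⟩ := hF
    obtain ⟨h01, h23⟩ := rch_pairing_partners G hFT h2 h3
    have he : s(x, y) ∈ G.edgeFinset := SimpleGraph.mem_edgeFinset.2 hxy
    have hjoin : ∀ F' η : Finset (Sym2 V), s(x, y) ∈ η → ∀ i j : Fin 4, Rch (F ∪ F' ∪ η) (a i) (a j) := by
      intro F' η hη
      have h02 : Rch (F ∪ F' ∪ η) (a 0) (a 2) :=
        ((rch_union_union hx).trans (rch_of_adj_mem hxy.ne hη)).trans (rch_union_union hy).symm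
      have h0 : ∀ i : Fin 4, Rch (F ∪ F' ∪ η) (a 0) (a i) := by
        intro i; fin_cases i
        · exact rch_refl _ _
        · exact rch_union_union h01
        · exact h02
        · exact h02.trans (rch_union_union h23)
      intro i j
      exact (h0 i).symm.trans (h0 j)
    have hη : ∀ F' ∈ tJoins G Set.univ (∅ : Finset V), t ^ 2 * (t ^ F.card * t ^ F'.card) ≤
        ∑ η ∈ G.edgeFinset.powerset, g F F' η := by
      intro F' _
      calc t ^ 2 * (t ^ F.card * t ^ F'.card)
          = ∑ η ∈ G.edgeFinset.powerset.filter (fun η => s(x, y) ∈ η), g F F' η := by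
            have : ∀ η ∈ G.edgeFinset.powerset.filter (fun η => s(x, y) ∈ η), g F F' η =
                t ^ F.card * t ^ F'.card * etaWeight G t η := by
              intro η hη
              rw [Finset.mem_filter] at hη
              simp only [hg, if_pos (hjoin F' η hη.2)]
            rw [Finset.sum_congr rfl this, ← Finset.mul_sum, sum_etaWeight_filter_mem G t he]
            ring
        _ ≤ ∑ η ∈ G.edgeFinset.powerset, g F F' η :=
            Finset.sum_le_sum_of_subset_of_nonneg (Finset.filter_subset _ _) fun η _ _ => hg0 F F' η
    calc t ^ 2 * t ^ F.card * loopO1PartitionFunction G t ∅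
        = ∑ F' ∈ tJoins G Set.univ (∅ : Finset V), t ^ 2 * (t ^ F.card * t ^ F'.card) := by
          rw [hZ0, Finset.mul_sum]
          refine Finset.sum_congr rfl fun F' _ => ?_
          ring
      _ ≤ _ := Finset.sum_le_sum hη
  -- assemble
  calc allJoinedMass G β a * loopO1PartitionFunction G t ∅ +
        t ^ 2 * (∑ F ∈ SC, t ^ F.card) * loopO1PartitionFunction G t ∅
      = ∑ F ∈ SA, t ^ F.card * loopO1PartitionFunction G t ∅ +
          ∑ F ∈ SC, t ^ 2 * t ^ F.card * loopO1PartitionFunction G t ∅ := by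
        rw [allJoinedMass, Finset.sum_mul, Finset.mul_sum, Finset.sum_mul]
    _ ≤ ∑ F ∈ SA, ∑ F' ∈ tJoins G Set.univ (∅ : Finset V), ∑ η ∈ G.edgeFinset.powerset, g F F' η +
          ∑ F ∈ SC, ∑ F' ∈ tJoins G Set.univ (∅ : Finset V), ∑ η ∈ G.edgeFinset.powerset, g F F' η := by
        refine add_le_add (le_of_eq (Finset.sum_congr rfl fun F hF => (hA F hF).symm)) ?_
        exact Finset.sum_le_sum hC
    _ = ∑ F ∈ SA ∪ SC, ∑ F' ∈ tJoins G Set.univ (∅ : Finset V), ∑ η ∈ G.edgeFinset.powerset, g F F' η := by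
        rw [Finset.sum_union hdisj]
    _ ≤ jointJoinMass G β a := by
        rw [hJJ]
        refine Finset.sum_le_sum_of_subset_of_nonneg (Finset.union_subset hSAsub hSCsub) ?_
        intro F _ _
        exact Finset.sum_nonneg fun F' _ => Finset.sum_nonneg fun η _ => hg0 F F' η

omit [Fintype V] [DecidableEq V] in
/-- **Contact floor ⇒ INT (arithmetic)**: Aizenman's dictionary `(ΣGG − ⟨σ_A⟩)·Z∅² = 2·JJ`,
`⟨σ_A⟩·Z∅ = Z_A = C₂₃ + C₁₃ + C₁₂ + AJ`, the pairing symmetry `C₁₃ = C₁₂ = C₂₃`, the contact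
inequality `AJ·Z∅ + t²·CM·Z∅ ≤ JJ`, a contact floor `p·C₂₃ ≤ CM` and GKS II `G₀₁G₂₃ ≤ ⟨σ_A⟩`
give `2κ·G₀₁G₂₃ ≤ ΣGG − ⟨σ_A⟩` with `κ = min(1, t²p/3)`. -/
theorem int_of_contactFloor_arith {JJ AJ Z0 ZA CM C23 C13 C12 σA G01 G23 G02 G13 G03 G12 t p : ℝ}
    (hp : 0 < p) (hZ0 : 0 < Z0) (hAJ : 0 ≤ AJ) (hC23 : 0 ≤ C23)
    (hcontact : AJ * Z0 + t ^ 2 * CM * Z0 ≤ JJ) (hfloor : p * C23 ≤ CM)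
    (hZA : ZA = C23 + C13 + C12 + AJ) (hC13 : C13 = C23) (hC12 : C12 = C23)
    (hdict : (G01 * G23 + G02 * G13 + G03 * G12 - σA) * Z0 ^ 2 = 2 * JJ)
    (hσZ : σA * Z0 = ZA) (hgks : G01 * G23 ≤ σA) :
    2 * min 1 (t ^ 2 * p / 3) * (G01 * G23) ≤ G01 * G23 + G02 * G13 + G03 * G12 - σA := by
  set κ := min 1 (t ^ 2 * p / 3) with hκ
  have hκ1 : κ ≤ 1 := min_le_left _ _
  have hκl : κ ≤ t ^ 2 * p / 3 := min_le_right _ _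
  have ht2 : 0 ≤ t ^ 2 := sq_nonneg t
  have hκ0 : 0 ≤ κ := le_min zero_le_one (by positivity)
  have hZA' : ZA = 3 * C23 + AJ := by rw [hZA, hC13, hC12]; ring
  have hJJ : κ * ZA * Z0 ≤ JJ := by
    have h1 : κ * (AJ * Z0) ≤ AJ * Z0 := by nlinarith [mul_nonneg hAJ hZ0.le]
    have h2 : κ * (3 * C23 * Z0) ≤ t ^ 2 * CM * Z0 := by
      have h2a : κ * (3 * C23) ≤ t ^ 2 * p * C23 := by nlinarith
      have h2b : t ^ 2 * p * C23 ≤ t ^ 2 * CM := by nlinarith [mul_le_mul_of_nonneg_left hfloor ht2]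
      nlinarith [hZ0.le]
    calc κ * ZA * Z0 = κ * (AJ * Z0) + κ * (3 * C23 * Z0) := by rw [hZA']; ring
      _ ≤ AJ * Z0 + t ^ 2 * CM * Z0 := add_le_add h1 h2
      _ ≤ JJ := hcontact
  have h3 : (2 * κ * σA) * Z0 ^ 2 ≤ (G01 * G23 + G02 * G13 + G03 * G12 - σA) * Z0 ^ 2 := by
    rw [hdict]
    calc (2 * κ * σA) * Z0 ^ 2 = 2 * (κ * (σA * Z0) * Z0) := by ring
      _ = 2 * (κ * ZA * Z0) := by rw [hσZ]
      _ ≤ 2 * JJ := by linarith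
  have h4 : 2 * κ * σA ≤ G01 * G23 + G02 * G13 + G03 * G12 - σA :=
    le_of_mul_le_mul_right h3 (pow_pos hZ0 2)
  calc 2 * κ * (G01 * G23) ≤ 2 * κ * σA := by nlinarith [hgks, hκ0]
    _ ≤ _ := h4

end Contact

section ContactINT

variable {V : Type} [Fintype V] [DecidableEq V] (G : SimpleGraph V) [DecidableRel G.Adj]

omit [Fintype V] in
/-- `{a₀,a₁} ∆ {a₂,a₃} = A` for injective `a`. -/
theorem contact_pair_symmDiff_pair {a : Fin 4 → V} (ha : Function.Injective a) :
    symmDiff ({a 0, a 1} : Finset V) {a 2, a 3} = Finset.univ.image a := by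
  have hdisj : Disjoint ({a 0, a 1} : Finset V) {a 2, a 3} := by
    rw [Finset.disjoint_left]
    intro v hv hv'
    simp only [Finset.mem_insert, Finset.mem_singleton] at hv hv'
    rcases hv with rfl | rfl <;> rcases hv' with h | h <;> exact absurd (ha h) (by decide)
  rw [hdisj.symmDiff_eq_sup]
  ext v
  simp only [Finset.sup_eq_union, Finset.mem_union, Finset.mem_insert, Finset.mem_singleton,
    Finset.mem_image, Finset.mem_univ, true_and]
  constructor
  · rintro ((rfl | rfl) | (rfl | rfl)) <;> exact ⟨_, rfl⟩
  · rintro ⟨i, rfl⟩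
    fin_cases i <;> simp

/-- **INT at one scale from a contact floor** (finite graph, `β ≥ 0`, `a` injective): Aizenman's
loop dictionary at `(G, β, a)` (the statement of `stub_aizenmanLoopDictionary`, hypothesis
`hdict`), the pairing symmetry `C₁₃ = C₁₂ = C₂₃` (hypothesis `hsym`; on the box a consequence of
the tetrahedral coordinate symmetry) and a CONTACT FLOOR `p·C₂₃ ≤ Σ_{contact pairings} t^{|F|}`
give the lattice clause (iii) at this scale, `2κ·G₀₁G₂₃ ≤ ΣGG − ⟨σ_A⟩`, `κ = min(1, t²p/3)` —
verbatim the hypothesis `hINT` of `StrandShadowSketch.clean_core` (INT → C′). -/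
theorem int_of_contact_core {β p : ℝ} (hβ : 0 ≤ β) (hp : 0 < p) (a : Fin 4 → V)
    (ha : Function.Injective a)
    (hdict : (let t : ℝ := Real.tanh β
       let Gc : Fin 4 → Fin 4 → ℝ := fun i j => isingCorr G Finset.univ β 0 .free {a i, a j}
       let C : Fin 4 → Fin 4 → ℝ := fun j k =>
         ∑ F ∈ (tJoins G Set.univ (Finset.univ.image a)).filter (fun F : Finset (Sym2 V) =>
            ¬ (SimpleGraph.fromEdgeSet (↑F : Set (Sym2 V))).Reachable (a 0) (a j) ∧
            ¬ (SimpleGraph.fromEdgeSet (↑F : Set (Sym2 V))).Reachable (a 0) (a k)),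
           t ^ F.card
       (Gc 0 1 * Gc 2 3 + Gc 0 2 * Gc 1 3 + Gc 0 3 * Gc 1 2
           - isingCorr G Finset.univ β 0 .free (Finset.univ.image a))
           * loopO1PartitionFunction G t ∅ ^ 2 = 2 * jointJoinMass G β a ∧
       loopO1PartitionFunction G t (Finset.univ.image a) = C 2 3 + C 1 3 + C 1 2 + allJoinedMass G β a))
    (hsym : (let C : Fin 4 → Fin 4 → ℝ := fun j k =>
         ∑ F ∈ (tJoins G Set.univ (Finset.univ.image a)).filter (fun F : Finset (Sym2 V) =>
            ¬ (SimpleGraph.fromEdgeSet (↑F : Set (Sym2 V))).Reachable (a 0) (a j) ∧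
            ¬ (SimpleGraph.fromEdgeSet (↑F : Set (Sym2 V))).Reachable (a 0) (a k)),
           Real.tanh β ^ F.card
       C 1 3 = C 2 3 ∧ C 1 2 = C 2 3))
    (hfloor : p * (∑ F ∈ pairingSet G a, Real.tanh β ^ F.card) ≤
       ∑ F ∈ (pairingSet G a).filter (fun F : Finset (Sym2 V) =>
              ∃ x y : V, G.Adj x y ∧ Rch F (a 0) x ∧ Rch F (a 2) y), Real.tanh β ^ F.card) :
    (let Gc : Fin 4 → Fin 4 → ℝ := fun i j => isingCorr G Finset.univ β 0 .free {a i, a j}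
     2 * min 1 (Real.tanh β ^ 2 * p / 3) * (Gc 0 1 * Gc 2 3) ≤
       Gc 0 1 * Gc 2 3 + Gc 0 2 * Gc 1 3 + Gc 0 3 * Gc 1 2
         - isingCorr G Finset.univ β 0 .free (Finset.univ.image a)) := by
  simp only at hdict hsym ⊢
  obtain ⟨hd1, hd2⟩ := hdict
  obtain ⟨hC13, hC12⟩ := hsym
  have ht : 0 ≤ Real.tanh β := by
    rw [Real.tanh_eq_sinh_div_cosh]
    exact div_nonneg (Real.sinh_nonneg_iff.2 hβ) (Real.cosh_pos _).le
  have hZ0 := loopO1PartitionFunction_empty_pos G ht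
  have hσZ := StrandShadowSketch.isingCorr_univ_mul_loopO1_empty G β (Finset.univ.image a)
  have hgks : isingCorr G Finset.univ β 0 .free {a 0, a 1} * isingCorr G Finset.univ β 0 .free {a 2, a 3}
      ≤ isingCorr G Finset.univ β 0 .free (Finset.univ.image a) := by
    have h := GKSInequalities.gks_two_holds G (Λ := Finset.univ) (A := {a 0, a 1}) (B := {a 2, a 3})
      (β := β) (h := 0) (bc := .free) hβ le_rfl (Or.inl rfl) (Finset.subset_univ _)
      (Finset.subset_univ _)
    rwa [contact_pair_symmDiff_pair ha] at h
  have hcontact := jointJoinMass_ge_allJoined_add_contact V G β hβ a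
  have hAJ : 0 ≤ allJoinedMass G β a := Finset.sum_nonneg fun F _ => pow_nonneg ht _
  have hC23 : 0 ≤ ∑ F ∈ pairingSet G a, Real.tanh β ^ F.card :=
    Finset.sum_nonneg fun F _ => pow_nonneg ht _
  have hps : (∑ F ∈ (tJoins G Set.univ (Finset.univ.image a)).filter (fun F : Finset (Sym2 V) =>
            ¬ (SimpleGraph.fromEdgeSet (↑F : Set (Sym2 V))).Reachable (a 0) (a 2) ∧
            ¬ (SimpleGraph.fromEdgeSet (↑F : Set (Sym2 V))).Reachable (a 0) (a 3)),
           Real.tanh β ^ F.card) = ∑ F ∈ pairingSet G a, Real.tanh β ^ F.card := rfl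
  rw [hps] at hd2 hC13 hC12
  exact int_of_contactFloor_arith hp hZ0 hAJ hC23 hcontact hfloor hd2 hC13 hC12 hd1 hσZ hgks

end ContactINT

end Summit.CriticalPhenomena.Ising3DConformalLimit.Theorems.StrandShadowOddCut

end
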